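import Summits.Ventures.LatticeQCDFlow.Scoring.LagProductCLT
import Summits.Ventures.LatticeQCDFlow.Scoring.MultivariateDeltaMethod
import Summits.Ventures.LatticeQCDFlow.Scoring.MadrasSokalRatioVariance

/-!
# THE CENTRAL LIMIT THEOREM FOR THE WINDOWED `τ_int` ESTIMATOR: `√N (τ̂_W − τ_W) ⇒ N(0, ℓᵀ Σ ℓ)` by the delta method, and `ℓᵀ Σ ℓ = R(W)` in the Gaussian (Wick) model

HONEST FRAMING: exact (Metropolis-corrected) sampling algorithms for lattice gauge theory;
figures of merit are autocorrelation/cost numbers at stated couplings and volumes; no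
continuum-physics claim.

Venture `LatticeQCDFlow` (cell pub-lqcd), sub-topic `Scoring`; FANOUT row 16 (`su2-base`, the
4D SU(2) baselines), GEN-7.  NEW WORK of the cell over `Scoring/LagProductCLT`,
`Scoring/BlockFactorBartlett`, row 4's `Scoring/MultivariateDeltaMethod` (the Fréchet delta method)
and GEN-6's `Scoring/MadrasSokalRatioVariance` (`tauHatRatioLin`, `tauHatRatioAVar = R(W)`,
`tendsto_variance_tauHatRatioLin`); nothing is cited as a fact.  Printed counterparts NAMED ONLY:
Madras–Sokal 1988 App. C and Wolff 2004 §3 (the error of `τ̂_int`); Priestley 1981 §5.3.4; the delta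
method (Cramér 1946 §27.7; van der Vaart 1998 Thm 3.1).

Sixth file of the LAW-OF-THE-ERROR packet and its point.  Row 16's acceptance (d) 'errors on
τ_int ≤ 15 %' compares `|τ̂ − τ|` with the PRINTED bar `δτ = τ√((4W+2)/N)`.  GEN-6 derived the bar as
the large-window asymptote of `R(W) = lim N·Var[τ̂_W^lin]` in the Gaussian model and listed as NOT
CLAIMED 'a CLT or any distributional statement for τ̂' and 'the delta-method remainder of the ratio'.
Both are supplied here, for the scorers' actual (nonlinear) ratio statistic
`τ̂_W = ½ + Σ_{t=1}^{W} Γ̂_N(t)/Γ̂_N(0)` = `tauIntWindow ρ̂_N W`: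

## Contents

* `tauHatFn W v = ½ + Σ_{t=1}^{W} v_t/v_0` on `ℝ^{W+1}`, `tauHatFn_toLp` (`= tauIntWindow (t ↦ v_t/v_0) W`),
  `tauHatGrad W c` (the gradient `ℓ`: `ℓ_0 = −(Σ_{t≥1} c_t)/c_0²`, `ℓ_t = 1/c_0`), `crd`, `tauHatDeriv`,
  **`hasFDerivAt_tauHatFn`** (Fréchet differentiable wherever `c_0 ≠ 0`), **`tauHatDeriv_apply`**
  (the derivative is `z ↦ ⟪ℓ, z⟫`), `measurable_tauHatFn`, `measurable_acovHat_blockFactor`.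
* **`tendstoInDistribution_tauIntWindow`** — THE CLT: `ξ` i.i.d., `X_i = F(ξ_i..ξ_{i+m})` with
  square-integrable lag products, `c(0) = E X_0² ≠ 0`, `Z` the Gaussian limit of the autocovariance
  vector (`⟪a,Z⟫ ~ N(0, aᵀΣa)`, `Σ = lagProdACov X (m+W)`): `√N (τ̂_W(N) − τ_W) ⇒ ⟪ℓ, Z⟫`, with
  `τ_W = tauIntWindow (t ↦ c(t)/c(0)) W`; `hasLaw_inner_tauHatGrad` — `⟪ℓ, Z⟫ ~ N(0, ℓᵀ Σ ℓ)`.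
* `tauHatGrad_smul`, **`tauHatRatioLin_eq_grad`** (GEN-6's linearised statistic IS `τ_W + ⟪ℓ, Γ̂_N⟫`),
  **`tendsto_variance_tauHatRatioLin_blockFactor`** (`N·Var[τ̂_W^lin] → ℓᵀ Σ ℓ` for ANY block-factor
  process — the non-Gaussian version of GEN-6's limit), **`gradQuadForm_eq_tauHatRatioAVar`**
  (block factor + stationary Wick family with covariance `σ²ρ̄`, `Σ|ρ| < ∞`: `ℓᵀ Σ ℓ = R(W)` by
  uniqueness of limits), `integral_lagProd_eq_of_wick` (`c(t) = σ² ρ(t)`).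
* **`tendstoInDistribution_tauIntWindow_wick`** — THE LAW OF THE ERROR OF THE ERROR in the Gaussian
  model: `√N (τ̂_W(N) − tauIntWindow ρ W) ⇒ ⟪ℓ, Z⟫ ~ N(0, R(W))`.  With GEN-6
  (`tendsto_tauHatRatioAVar_div_printed`: `R(W)/((4W+2)τ²) → 1`; `eventually_tauHatRatioAVar_lt_printed`
  for `0 ≤ ρ ≤ 1`) this closes the chain from the data model to the printed bar: asymptotically in `N`
  the error `τ̂_W − τ_W` is Gaussian with standard deviation `√(R(W)/N)`, and the printed
  `τ√((4W+2)/N)` is its large-`W` form (an over-cover for non-negative autocorrelations).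

NOT CLAIMED: the truncation bias `τ_int − τ_W` (deterministic; `WolffWindow`/`MadrasSokalWindow`);
the coupling of a data-chosen window `W(τ̂)` with `τ̂` (here `W` is fixed); mean subtraction and
`1/(N−t)`; a studentised version with an estimated `R̂(W)`; Berry–Esseen; `σ²_τ > 0`; Markov-chain
(non-`m`-dependent) data — row 13's Doeblin-chain Γ-method files cover consistency there, not this law.
-/

noncomputable section

open MeasureTheory ProbabilityTheory Filter Finset WithLp
open scoped Topology NNReal RealInnerProductSpace

namespace Summit.Ventures.LatticeQCDFlow.Scoring

/-! ## The ratio map `v ↦ ½ + Σ_{t=1}^{W} v_t / v_0` and its derivative -/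

section RatioMap

variable {W : ℕ}

/-- The windowed ratio estimator as a function of the vector of autocovariances:
`τ(v) = ½ + Σ_{t=1}^{W} v_t / v_0`. [ours] -/
def tauHatFn (W : ℕ) (v : EuclideanSpace ℝ (Fin (W + 1))) : ℝ :=
  1 / 2 + ∑ t : Fin W, v t.succ / v 0

/-- Its GRADIENT at `c` (`c_0 ≠ 0`): `ℓ_0 = −(Σ_{t=1}^{W} c_t)/c_0²`, `ℓ_t = 1/c_0` (`t ≥ 1`). [ours] -/
def tauHatGrad (W : ℕ) (c : EuclideanSpace ℝ (Fin (W + 1))) : EuclideanSpace ℝ (Fin (W + 1)) :=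
  toLp 2 fun i : Fin (W + 1) => if i = 0 then -(∑ t : Fin W, c t.succ) / c 0 ^ 2 else 1 / c 0

/-- `τ(v)` is the scorers' `tauIntWindow` of the normalised vector `t ↦ v_t / v_0`. -/
theorem tauHatFn_toLp (v : ℕ → ℝ) :
    tauHatFn W (toLp 2 fun t : Fin (W + 1) => v t) = tauIntWindow (fun t => v t / v 0) W := by
  rw [tauHatFn, tauIntWindow, ← Fin.sum_univ_eq_sum_range (fun t => v (t + 1) / v 0)]
  rfl

/-- The `i`-th coordinate of `ℝ^{W+1}` as a continuous linear functional. [ours] -/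
abbrev crd (W : ℕ) (i : Fin (W + 1)) : EuclideanSpace ℝ (Fin (W + 1)) →L[ℝ] ℝ :=
  EuclideanSpace.proj (𝕜 := ℝ) i

/-- `crd W i v = v i`. -/
theorem crd_apply (i : Fin (W + 1)) (v : EuclideanSpace ℝ (Fin (W + 1))) : crd W i v = v i := rfl

/-- `τ` is measurable. -/
theorem measurable_tauHatFn (W : ℕ) : Measurable (tauHatFn W) := by
  unfold tauHatFn
  refine measurable_const.add (Finset.measurable_sum _ fun t _ => ?_)
  exact (crd W t.succ).measurable.div (crd W 0).measurable

/-- The derivative of `τ` at `c` as a continuous linear map (product and chain rules). [ours] -/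
def tauHatDeriv (W : ℕ) (c : EuclideanSpace ℝ (Fin (W + 1))) :
    EuclideanSpace ℝ (Fin (W + 1)) →L[ℝ] ℝ :=
  ∑ t : Fin W, (c t.succ • ((ContinuousLinearMap.toSpanSingleton ℝ (-(c 0 ^ 2)⁻¹)).comp (crd W 0))
    + (c 0)⁻¹ • crd W t.succ)

/-- **`τ` is Fréchet differentiable at every `c` with `c_0 ≠ 0`**, with derivative `tauHatDeriv`. -/
theorem hasFDerivAt_tauHatFn (c : EuclideanSpace ℝ (Fin (W + 1))) (hc : c 0 ≠ 0) :
    HasFDerivAt (tauHatFn W) (tauHatDeriv W c) c := by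
  have h0 : HasFDerivAt (crd W 0) (crd W 0) c := (crd W 0).hasFDerivAt
  have hinv : HasFDerivAt (fun v => (crd W 0 v)⁻¹)
      ((ContinuousLinearMap.toSpanSingleton ℝ (-(c 0 ^ 2)⁻¹)).comp (crd W 0)) c :=
    (hasFDerivAt_inv hc).comp c h0
  have hmul : ∀ t ∈ (univ : Finset (Fin W)),
      HasFDerivAt (fun v => crd W t.succ v * (crd W 0 v)⁻¹)
      (c t.succ • ((ContinuousLinearMap.toSpanSingleton ℝ (-(c 0 ^ 2)⁻¹)).comp (crd W 0))
        + (c 0)⁻¹ • crd W t.succ) c :=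
    fun t _ => (crd W t.succ).hasFDerivAt.mul hinv
  have h := (HasFDerivAt.fun_sum hmul).const_add (1 / 2 : ℝ)
  have e : tauHatFn W = fun v => 1 / 2 + ∑ t : Fin W, crd W t.succ v * (crd W 0 v)⁻¹ := by
    funext v; simp only [tauHatFn, crd_apply, div_eq_mul_inv]
  rw [e]
  exact h

/-- **The derivative IS the inner product with the gradient**: `tauHatDeriv W c z = ⟪ℓ, z⟫`. -/
theorem tauHatDeriv_apply (c z : EuclideanSpace ℝ (Fin (W + 1))) :
    tauHatDeriv W c z = ⟪tauHatGrad W c, z⟫ := by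
  rw [tauHatDeriv, PiLp.inner_apply, Fin.sum_univ_succ, tauHatGrad]
  simp only [FunLike.coe_sum, Finset.sum_apply, _root_.add_apply, _root_.smul_apply,
    ContinuousLinearMap.comp_apply, ContinuousLinearMap.toSpanSingleton_apply, crd_apply,
    smul_eq_mul, RCLike.inner_apply, conj_trivial, Fin.succ_ne_zero, if_true,
    if_false, sum_add_distrib, ← sum_mul, ← mul_sum]
  ring

end RatioMap

/-! ## The central limit theorem for `τ̂_W` -/

section CLT

variable {Ω : Type*} [MeasurableSpace Ω] {P : Measure Ω} [IsProbabilityMeasure P]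
variable {Ω' : Type*} [MeasurableSpace Ω'] {P' : Measure Ω'} [IsProbabilityMeasure P']
variable {S : Type*} [MeasurableSpace S] {ξ : ℕ → Ω → S} {m : ℕ} {F : (Fin (m + 1) → S) → ℝ}

omit [IsProbabilityMeasure P] in
/-- The empirical autocovariances of a block-factor process are measurable. -/
theorem measurable_acovHat_blockFactor (hξ : ∀ i, Measurable (ξ i)) (hF : Measurable F) (N t : ℕ) :
    Measurable (acovHat (blockFactor F ξ) N t) := by
  unfold acovHat
  exact (Finset.measurable_sum _ fun i _ =>
    (measurable_blockFactor hξ hF i).mul (measurable_blockFactor hξ hF (i + t))).div_const _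

/-- **THE CENTRAL LIMIT THEOREM FOR THE WINDOWED INTEGRATED-AUTOCORRELATION-TIME ESTIMATOR.**
`ξ` i.i.d., `X_i = F(ξ_i, …, ξ_{i+m})` with square-integrable lag products and `c(0) = E X_0² ≠ 0`;
`τ̂_W(N) = ½ + Σ_{t=1}^{W} Γ̂_N(t)/Γ̂_N(0)` (scorer A `tau_int_W` / scorer B, `tauIntWindow` of the sample
autocorrelation, known mean), `τ_W = ½ + Σ_{t=1}^{W} c(t)/c(0)`; `Z` the Gaussian limit of
`LagProductCLT.tendstoInDistribution_acovHat` (`⟪a, Z⟫ ~ N(0, aᵀ Σ a)`, `Σ = lagProdACov X (m+W)`) and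
`ℓ = tauHatGrad W c` the gradient of the ratio map.  Then
`√N (τ̂_W(N) − τ_W) ⇒ ⟪ℓ, Z⟫ ~ N(0, ℓᵀ Σ ℓ)` (delta method, `Scoring/MultivariateDeltaMethod`). -/
theorem tendstoInDistribution_tauIntWindow (hξ : ∀ i, Measurable (ξ i)) (hind : iIndepFun ξ P)
    (hid : ∀ i, IdentDistrib (ξ i) (ξ 0) P P) (hF : Measurable F)
    (h4 : ∀ t, MemLp (fun ω => blockFactor F ξ 0 ω * blockFactor F ξ t ω) 2 P) (W : ℕ)
    (hσ : P[fun ω => blockFactor F ξ 0 ω * blockFactor F ξ 0 ω] ≠ 0)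
    {Z : Ω' → EuclideanSpace ℝ (Fin (W + 1))} (hZm : AEMeasurable Z P')
    (hZ : ∀ a : EuclideanSpace ℝ (Fin (W + 1)), HasLaw (fun ω' => ⟪a, Z ω'⟫) (gaussianReal 0
      (∑ s : Fin (W + 1), ∑ t : Fin (W + 1),
        a s * a t * lagProdACov (blockFactor F ξ) P (m + W) s t).toNNReal) P') :
    TendstoInDistribution
      (fun (N : ℕ) ω => Real.sqrt N
        * (tauIntWindow (fun t => acovHat (blockFactor F ξ) N t ω / acovHat (blockFactor F ξ) N 0 ω) W
          - tauIntWindow (fun t => P[fun ω => blockFactor F ξ 0 ω * blockFactor F ξ t ω]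
              / P[fun ω => blockFactor F ξ 0 ω * blockFactor F ξ 0 ω]) W))
      atTop (fun ω' => ⟪tauHatGrad W (toLp 2 fun t : Fin (W + 1) =>
        P[fun ω => blockFactor F ξ 0 ω * blockFactor F ξ t ω]), Z ω'⟫) (fun _ => P) P' := by
  set cvec : EuclideanSpace ℝ (Fin (W + 1)) :=
    toLp 2 fun t : Fin (W + 1) => P[fun ω => blockFactor F ξ 0 ω * blockFactor F ξ t ω] with hcvec
  set T : ℕ → Ω → EuclideanSpace ℝ (Fin (W + 1)) :=
    fun N ω => toLp 2 fun t : Fin (W + 1) => acovHat (blockFactor F ξ) N t ω with hT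
  have hclt : TendstoInDistribution (fun (N : ℕ) ω => Real.sqrt N • (T N ω - cvec)) atTop Z
      (fun _ => P) P' :=
    tendstoInDistribution_acovHat hξ hind hid hF h4 W hZm hZ
  have hTm : ∀ N, AEMeasurable (T N) P := fun N => by
    have h : Measurable (T N) := (WithLp.measurable_toLp 2 _).comp
      (measurable_pi_lambda _ fun t => measurable_acovHat_blockFactor hξ hF N t)
    exact h.aemeasurable
  have hc0 : cvec 0 ≠ 0 := hσ
  have hD := CardConsistency.tendstoInDistribution_deltaMethod_fderiv
    (a := fun N : ℕ => Real.sqrt N) (Real.tendsto_sqrt_atTop.comp tendsto_natCast_atTop_atTop)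
    hclt hTm (hasFDerivAt_tauHatFn cvec hc0) (measurable_tauHatFn W)
  refine hD.congr (fun N => Eventually.of_forall fun ω => ?_) (Eventually.of_forall fun ω' => ?_)
  · rw [smul_eq_mul, hT, hcvec, tauHatFn_toLp (fun t => acovHat (blockFactor F ξ) N t ω),
      tauHatFn_toLp (fun t => P[fun ω => blockFactor F ξ 0 ω * blockFactor F ξ t ω])]
  · exact tauHatDeriv_apply cvec (Z ω')

omit [IsProbabilityMeasure P'] in
/-- **The limit law is `N(0, ℓᵀ Σ ℓ)`** — read off the hypothesis on `Z` at `a = ℓ`. -/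
theorem hasLaw_inner_tauHatGrad {W : ℕ} {Z : Ω' → EuclideanSpace ℝ (Fin (W + 1))}
    {M : Fin (W + 1) → Fin (W + 1) → ℝ}
    (hZ : ∀ a : EuclideanSpace ℝ (Fin (W + 1)), HasLaw (fun ω' => ⟪a, Z ω'⟫) (gaussianReal 0
      (∑ s : Fin (W + 1), ∑ t : Fin (W + 1), a s * a t * M s t).toNNReal) P')
    (c : EuclideanSpace ℝ (Fin (W + 1))) :
    HasLaw (fun ω' => ⟪tauHatGrad W c, Z ω'⟫) (gaussianReal 0
      (∑ s : Fin (W + 1), ∑ t : Fin (W + 1),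
        tauHatGrad W c s * tauHatGrad W c t * M s t).toNNReal) P' :=
  hZ (tauHatGrad W c)

end CLT

/-! ## Under the Wick hypothesis the limit variance is GEN-6's `R(W)` -/

section Wick

variable {Ω : Type*} [MeasurableSpace Ω] {P : Measure Ω} [IsProbabilityMeasure P]
variable {S : Type*} [MeasurableSpace S] {ξ : ℕ → Ω → S} {m : ℕ} {F : (Fin (m + 1) → S) → ℝ}

/-- The gradient at the truth `c = σ² ρ` (`ρ(0) = 1`): `ℓ_0 = −(Σ_{t=1}^{W} ρ(t))/σ²`, `ℓ_t = 1/σ²`. -/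
theorem tauHatGrad_smul {σ2 : ℝ} (hσ : σ2 ≠ 0) {ρ : ℕ → ℝ} (h0 : ρ 0 = 1) (W : ℕ)
    (i : Fin (W + 1)) :
    tauHatGrad W (toLp 2 fun t : Fin (W + 1) => σ2 * ρ t) i
      = if i = 0 then -(∑ t : Fin W, ρ (t + 1)) / σ2 else 1 / σ2 := by
  simp only [tauHatGrad, PiLp.toLp_apply, Fin.val_zero, h0, mul_one, Fin.val_succ, ← mul_sum]
  split_ifs
  · field_simp
  · rfl

omit [MeasurableSpace Ω] [IsProbabilityMeasure P] in
/-- **GEN-6's linearised ratio statistic is `τ_W + ⟪ℓ, Γ̂⟫`**: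
`tauHatRatioLin X σ² ρ N W = τ_W + Σ_i ℓ_i Γ̂_N(i)` with `ℓ = tauHatGrad W (σ² ρ)`. -/
theorem tauHatRatioLin_eq_grad (X : ℕ → Ω → ℝ) {σ2 : ℝ} (hσ : σ2 ≠ 0) {ρ : ℕ → ℝ} (h0 : ρ 0 = 1)
    (N W : ℕ) (ω : Ω) :
    tauHatRatioLin X σ2 ρ N W ω = tauIntWindow ρ W
      + ∑ i : Fin (W + 1), tauHatGrad W (toLp 2 fun t : Fin (W + 1) => σ2 * ρ t) i * acovHat X N i ω := by
  rw [tauHatRatioLin, Fin.sum_univ_succ]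
  simp only [tauHatGrad_smul hσ h0, Fin.succ_ne_zero, if_true, if_false, Fin.val_zero, Fin.val_succ]
  rw [← Fin.sum_univ_eq_sum_range (fun t => acovHat X N (t + 1) ω - ρ (t + 1) * acovHat X N 0 ω)]
  simp only [sum_sub_distrib, sub_div, sum_div, ← sum_mul]
  field_simp
  ring

/-- **`N · Var[τ̂_W^lin] → ℓᵀ Σ ℓ` for a block-factor process** (the variance of the linear statistic
is the quadratic form of the covariances of the `Γ̂_N(t)`, each of which obeys Bartlett's formula
`BlockFactorBartlett.tendsto_covariance_acovHat_blockFactor`). -/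
theorem tendsto_variance_tauHatRatioLin_blockFactor (hξ : ∀ i, Measurable (ξ i)) (hind : iIndepFun ξ P)
    (hid : ∀ i, IdentDistrib (ξ i) (ξ 0) P P) (hF : Measurable F)
    (h4 : ∀ t, MemLp (fun ω => blockFactor F ξ 0 ω * blockFactor F ξ t ω) 2 P)
    {σ2 : ℝ} (hσ : σ2 ≠ 0) {ρ : ℕ → ℝ} (h0 : ρ 0 = 1) (W : ℕ) :
    Tendsto (fun N : ℕ => (N : ℝ) * Var[tauHatRatioLin (blockFactor F ξ) σ2 ρ N W; P]) atTop
      (𝓝 (∑ s : Fin (W + 1), ∑ t : Fin (W + 1),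
        tauHatGrad W (toLp 2 fun t : Fin (W + 1) => σ2 * ρ t) s
          * tauHatGrad W (toLp 2 fun t : Fin (W + 1) => σ2 * ρ t) t
          * lagProdACov (blockFactor F ξ) P (m + W) s t)) := by
  set ℓ := tauHatGrad W (toLp 2 fun t : Fin (W + 1) => σ2 * ρ t) with hℓ
  have hacov : ∀ N t : ℕ, MemLp (acovHat (blockFactor F ξ) N t) 2 P := by
    intro N t
    have heq : acovHat (blockFactor F ξ) N t = fun ω =>
        (∑ j ∈ range N, blockFactor F ξ j ω * blockFactor F ξ (j + t) ω) * (1 / (N : ℝ)) := by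
      funext ω; rw [acovHat_apply, div_eq_mul_one_div]
    rw [heq]
    exact (memLp_finsetSum _ fun j _ => memLp_lagProd hind hid hF h4 j t).mul_const _
  have hm : ∀ N (i : Fin (W + 1)), MemLp (fun ω => ℓ i * acovHat (blockFactor F ξ) N i ω) 2 P :=
    fun N i => (hacov N i).const_mul (ℓ i)
  have hvar : ∀ N : ℕ, Var[tauHatRatioLin (blockFactor F ξ) σ2 ρ N W; P]
      = ∑ s : Fin (W + 1), ∑ t : Fin (W + 1),
          ℓ s * ℓ t * cov[acovHat (blockFactor F ξ) N s, acovHat (blockFactor F ξ) N t; P] := by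
    intro N
    have e : tauHatRatioLin (blockFactor F ξ) σ2 ρ N W
        = fun ω => tauIntWindow ρ W + ∑ i : Fin (W + 1), ℓ i * acovHat (blockFactor F ξ) N i ω := by
      funext ω; exact tauHatRatioLin_eq_grad _ hσ h0 N W ω
    rw [e, variance_const_add, variance_fun_sum fun i => hm N i]
    · refine sum_congr rfl fun s _ => sum_congr rfl fun t _ => ?_
      rw [covariance_const_mul_left, covariance_const_mul_right, mul_assoc]
    · exact (memLp_finsetSum univ fun i _ => hm N i).aestronglyMeasurable
  simp_rw [hvar, mul_sum]
  refine tendsto_finsetSum _ fun s _ => tendsto_finsetSum _ fun t _ => ?_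
  have h := (tendsto_covariance_acovHat_blockFactor hξ hind hid hF h4 (W := W) s t).const_mul (ℓ s * ℓ t)
  refine h.congr fun N => ?_
  ring

/-- **THE LIMIT VARIANCE IS `R(W)`.**  For a block-factor process that is also a stationary Wick family
with covariance `σ² ρ̄` (`σ² ≠ 0`, `ρ(0) = 1`, `Σ|ρ| < ∞`) — e.g. a Gaussian moving average — the
delta-method variance `ℓᵀ Σ ℓ` of `√N (τ̂_W − τ_W)` EQUALS GEN-6's `tauHatRatioAVar ρ W = R(W)`, the
`N → ∞` limit of `N · Var[τ̂_W^lin]` (`MadrasSokalRatioVariance`): both are limits of the same sequence. -/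
theorem gradQuadForm_eq_tauHatRatioAVar (hξ : ∀ i, Measurable (ξ i)) (hind : iIndepFun ξ P)
    (hid : ∀ i, IdentDistrib (ξ i) (ξ 0) P P) (hF : Measurable F)
    {C : ℕ → ℕ → ℝ} (hW : IsWickFamily (blockFactor F ξ) C P) {σ2 : ℝ} {ρ : ℕ → ℝ}
    (hC : ∀ i j, C i j = σ2 * evenExt ρ ((j : ℤ) - i)) (hσ : σ2 ≠ 0) (h0 : ρ 0 = 1)
    (hρ : Summable ρ) (W : ℕ) :
    ∑ s : Fin (W + 1), ∑ t : Fin (W + 1),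
        tauHatGrad W (toLp 2 fun t : Fin (W + 1) => σ2 * ρ t) s
          * tauHatGrad W (toLp 2 fun t : Fin (W + 1) => σ2 * ρ t) t
          * lagProdACov (blockFactor F ξ) P (m + W) s t
      = tauHatRatioAVar ρ W :=
  tendsto_nhds_unique
    (tendsto_variance_tauHatRatioLin_blockFactor hξ hind hid hF (fun t => hW.memLp 0 t) hσ h0 W)
    (hW.tendsto_variance_tauHatRatioLin hC hσ hρ W)

omit [IsProbabilityMeasure P] [MeasurableSpace S] in
/-- Under the Wick hypothesis the truth vector is `c(t) = E[X_0 X_t] = σ² ρ(t)`. -/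
theorem integral_lagProd_eq_of_wick {C : ℕ → ℕ → ℝ} (hW : IsWickFamily (blockFactor F ξ) C P)
    {σ2 : ℝ} {ρ : ℕ → ℝ} (hC : ∀ i j, C i j = σ2 * evenExt ρ ((j : ℤ) - i)) (t : ℕ) :
    P[fun ω => blockFactor F ξ 0 ω * blockFactor F ξ t ω] = σ2 * ρ t := by
  rw [hW.two 0 t, hC]
  simp [evenExt_natCast]

/-- **THE LAW OF THE ERROR OF THE ERROR (Gaussian / Wick model).**  For a block-factor process that
is a stationary Wick family with covariance `σ² ρ̄` (`σ² ≠ 0`, `ρ(0) = 1`, `Σ|ρ| < ∞`) and every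
Gaussian limit `Z` of the empirical autocovariances:
`√N (τ̂_W(N) − τ_W) ⇒ ⟪ℓ, Z⟫` with `τ_W = tauIntWindow ρ W` the windowed truth, AND `⟪ℓ, Z⟫ ~ N(0, R(W))`
with `R(W) = tauHatRatioAVar ρ W` — GEN-6's limit of `N · Var`, whose large-window asymptote
`(4W+2) τ_int²` is the square of the PRINTED Madras–Sokal bar times `N`
(`MadrasSokalRatioVariance.tendsto_tauHatRatioAVar_div_printed`). -/
theorem tendstoInDistribution_tauIntWindow_wick {Ω' : Type*} [MeasurableSpace Ω'] {P' : Measure Ω'}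
    [IsProbabilityMeasure P'] (hξ : ∀ i, Measurable (ξ i)) (hind : iIndepFun ξ P)
    (hid : ∀ i, IdentDistrib (ξ i) (ξ 0) P P) (hF : Measurable F)
    {C : ℕ → ℕ → ℝ} (hW : IsWickFamily (blockFactor F ξ) C P) {σ2 : ℝ} {ρ : ℕ → ℝ}
    (hC : ∀ i j, C i j = σ2 * evenExt ρ ((j : ℤ) - i)) (hσ : σ2 ≠ 0) (h0 : ρ 0 = 1)
    (hρ : Summable ρ) (W : ℕ) {Z : Ω' → EuclideanSpace ℝ (Fin (W + 1))} (hZm : AEMeasurable Z P')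
    (hZ : ∀ a : EuclideanSpace ℝ (Fin (W + 1)), HasLaw (fun ω' => ⟪a, Z ω'⟫) (gaussianReal 0
      (∑ s : Fin (W + 1), ∑ t : Fin (W + 1),
        a s * a t * lagProdACov (blockFactor F ξ) P (m + W) s t).toNNReal) P') :
    TendstoInDistribution
      (fun (N : ℕ) ω => Real.sqrt N
        * (tauIntWindow (fun t => acovHat (blockFactor F ξ) N t ω / acovHat (blockFactor F ξ) N 0 ω) W
          - tauIntWindow ρ W))
      atTop (fun ω' => ⟪tauHatGrad W (toLp 2 fun t : Fin (W + 1) => σ2 * ρ t), Z ω'⟫) (fun _ => P) P'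
    ∧ HasLaw (fun ω' => ⟪tauHatGrad W (toLp 2 fun t : Fin (W + 1) => σ2 * ρ t), Z ω'⟫)
        (gaussianReal 0 (tauHatRatioAVar ρ W).toNNReal) P' := by
  have hc : ∀ t : ℕ, P[fun ω => blockFactor F ξ 0 ω * blockFactor F ξ t ω] = σ2 * ρ t :=
    integral_lagProd_eq_of_wick hW hC
  have hcvec : (toLp 2 fun t : Fin (W + 1) => P[fun ω => blockFactor F ξ 0 ω * blockFactor F ξ t ω])
      = toLp 2 fun t : Fin (W + 1) => σ2 * ρ t := by
    congr 1; funext t; exact hc t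
  have hσ' : P[fun ω => blockFactor F ξ 0 ω * blockFactor F ξ 0 ω] ≠ 0 := by
    rw [hc 0, h0, mul_one]; exact hσ
  have hτ : tauIntWindow (fun t => P[fun ω => blockFactor F ξ 0 ω * blockFactor F ξ t ω]
      / P[fun ω => blockFactor F ξ 0 ω * blockFactor F ξ 0 ω]) W = tauIntWindow ρ W := by
    simp only [tauIntWindow, hc, h0, mul_one]
    congr 1
    refine sum_congr rfl fun t _ => ?_
    field_simp
  refine ⟨?_, ?_⟩
  · have h := tendstoInDistribution_tauIntWindow hξ hind hid hF (fun t => hW.memLp 0 t) W hσ' hZm hZ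
    rw [hτ, hcvec] at h
    exact h
  · have h := hasLaw_inner_tauHatGrad hZ (toLp 2 fun t : Fin (W + 1) => σ2 * ρ t)
    rwa [gradQuadForm_eq_tauHatRatioAVar hξ hind hid hF hW hC hσ h0 hρ W] at h

end Wick

end Summit.Ventures.LatticeQCDFlow.Scoring

end
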